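import Summits.ResolutionOfSingularities.ResolutionOfSingularities.Theorems.UniversalCellsCampaignW82DifferentialCriterionRatFunc
import Literature.AlgebraicGeometry.Resolution.SmoothStalksRegular
import Literature.AlgebraicGeometry.Resolution.ResolutionOfSingularities
import Mathlib.AlgebraicGeometry.Morphisms.Smooth
import HarnessLib

/-!
# [OURS · L1 W8.2] THE 1-FORM CRITERION FOR SCHEMES over `M(t)`: a point `y` of `Y → Spec M(t)` with regular local
# ring is a smooth point iff `dt(y) ≠ 0`; `Y` is smooth over `M(t)` iff `Y` is regular and `dt` vanishes nowhere

Cell `res-hironaka` (run/shared/lean/pub/res-hironaka/), LADDER-RESOLUTION rung L (RESCUE), slot W8.2; host route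
`UniversalCells`, host item `PrimeFieldToPerfect` (stmt-ResolutionOfSingularities-15233), door 1. Proofs file
(Theses-free), written by res-L1-s82-pv-1 (gen 7); scheme form of `…DifferentialCriterionRatFunc` (form (E6) of
Cruxes/PrimeFieldToPerfect/KERNEL.md §2). For `q : Y ⟶ Spec K` and `y ∈ Y` the local ring `𝒪_{Y,y}` is a `K`-algebra
through «constants»: `K = Γ(Spec K) → Γ(Y) → 𝒪_{Y,y}` (written out in each statement as a `RingHom.toAlgebra`, no new
definition); for `K = M(t)` it is thereby an `M`-algebra and `dt(y) := 1 ⊗ d(t) ∈ κ(y) ⊗ Ω_{𝒪_{Y,y}/M}` makes sense.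

* `mem_smoothLocus_iff_formallySmooth_stalk` — ANY field `K`, `q` locally of finite presentation: `y` is a smooth
  point of `q` iff `𝒪_{Y,y}` is formally smooth over `K` (Mathlib's `smoothLocus` is «the stalk MAP
  `𝒪_{Spec K, q y} → 𝒪_{Y,y}` is formally smooth»; `𝒪_{Spec K, q y}` is a localization of `K`).
* `essFiniteType_stalk` — `𝒪_{Y,y}` is essentially of finite type over `K` (`q` locally of finite type).
* **`mem_smoothLocus_iff_tmul_D_ne_zero`** — `K = M(t)`, `M` PERFECT, `𝒪_{Y,y}` regular: `y ∈ sm(q)` iff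
  `dt(y) ≠ 0`.
* **`smooth_iff_isRegular_and_forall_tmul_D_ne_zero`** — `q` is smooth iff `Y` is regular and `dt(y) ≠ 0` for every
  `y` («the 1-form `dt` vanishes nowhere on `Y`»); on a regular `Y` the non-smooth locus is the zero locus of `dt`.

The by-name reading of the W8.2 residual (`HasSmoothFrobeniusTwistModel` / `FrobeniusTwistStepAt` with «smooth»
replaced by «regular with `dt` nowhere zero») is the links leaf `…DifferentialCriterionLinks`.

HONEST FRAMING. OURS theorems (classical; EGA 0_IV 20.5.7, Stacks 00TV/056S, assembled from Mathlib and the tree);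
they replace the role of no printed item of [Hironaka2017] and are NOT statements of the manuscript; nothing is
attributed to its author. A normal form, not progress on the open residual. AI work, weaker than expert review; no
claim beyond the kernel. No `sorry`, no new axioms.
-/

noncomputable section

set_option linter.dupNamespace false -- mandated namespace of this single-conjunct summit

open CategoryTheory CategoryTheory.Limits AlgebraicGeometry TopologicalSpace TensorProduct IsLocalRing
open scoped RatFunc
open Literature.AlgebraicGeometry.Resolution

namespace Summit.ResolutionOfSingularities.ResolutionOfSingularities.Theorems.CampaignW82

universe u

/-! ## §1 Smooth point ⟺ the local ring is formally smooth over the ground field -/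

section AnyField

variable {K : Type u} [Field K] {Y : Scheme.{u}} (q : Y ⟶ Spec (.of K))

/-- The structure map `K → 𝒪_{Y,y}` «through constants» (`K = Γ(Spec K) → Γ(Y) → 𝒪_{Y,y}`) is the stalk map
of `q` at `y` composed with `K → 𝒪_{Spec K, q y}`. [folklore] -/
theorem toStalk_comp_stalkMap_eq (y : Y) :
    StructureSheaf.toStalk K (q.base y) ≫ q.stalkMap y =
      (Scheme.ΓSpecIso (.of K)).inv ≫ q.appTop ≫ Y.presheaf.germ ⊤ y trivial := by
  have h : (Spec (.of K)).presheaf.germ ⊤ (q.base y) trivial ≫ q.stalkMap y =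
      q.appTop ≫ Y.presheaf.germ ⊤ y trivial := Scheme.Hom.germ_stalkMap q ⊤ y trivial
  rw [← h]
  rfl

/-- **Smooth point ⟺ formally smooth local ring** (`q : Y ⟶ Spec K` locally of finite presentation, ANY field `K`,
`𝒪_{Y,y}` a `K`-algebra through constants): `y ∈ sm(q)` iff `𝒪_{Y,y}` is formally smooth over `K`. (Mathlib's
`y ∈ q.smoothLocus` is formal smoothness of `𝒪_{Spec K, q y} → 𝒪_{Y,y}`, and `K → 𝒪_{Spec K, q y}` is a
localization.) [folklore] -/
theorem mem_smoothLocus_iff_formallySmooth_stalk [LocallyOfFinitePresentation q] (y : Y) :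
    letI : Algebra K (Y.presheaf.stalk y) :=
      ((Scheme.ΓSpecIso (.of K)).inv ≫ q.appTop ≫ Y.presheaf.germ ⊤ y trivial).hom.toAlgebra
    y ∈ q.smoothLocus ↔ Algebra.FormallySmooth K (Y.presheaf.stalk y) := by
  letI : Algebra K (Y.presheaf.stalk y) :=
    ((Scheme.ΓSpecIso (.of K)).inv ≫ q.appTop ≫ Y.presheaf.germ ⊤ y trivial).hom.toAlgebra
  -- `K' = 𝒪_{Spec K, q y}`, a localization of `K`
  let K' := (Spec (.of K)).presheaf.stalk (q.base y)
  letI : Algebra K K' := (StructureSheaf.toStalk K (q.base y)).hom.toAlgebra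
  haveI : IsLocalization.AtPrime K' (q.base y).asIdeal := StructureSheaf.IsLocalization.to_stalk K (q.base y)
  letI : Algebra K' (Y.presheaf.stalk y) := (q.stalkMap y).hom.toAlgebra
  haveI : IsScalarTower K K' (Y.presheaf.stalk y) := by
    refine IsScalarTower.of_algebraMap_eq' ?_
    exact RingHom.ext fun r =>
      (congrArg (fun f => CommRingCat.Hom.hom f r) (toStalk_comp_stalkMap_eq q y)).symm
  haveI : Algebra.FormallySmooth K K' :=
    Algebra.FormallySmooth.of_isLocalization (Rₘ := K') (q.base y).asIdeal.primeCompl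
  rw [Scheme.Hom.mem_smoothLocus]
  constructor
  · intro h
    have h' : Algebra.FormallySmooth K' (Y.presheaf.stalk y) := h
    exact Algebra.FormallySmooth.comp K K' (Y.presheaf.stalk y)
  · intro h
    have h' : Algebra.FormallySmooth K' (Y.presheaf.stalk y) :=
      Algebra.FormallySmooth.localization_base (Rₘ := K') (Sₘ := Y.presheaf.stalk y)
        (q.base y).asIdeal.primeCompl
    exact h'

/-- `𝒪_{Y,y}` is essentially of finite type over `K` (through constants) when `q` is locally of finite type.
[folklore] -/
theorem essFiniteType_stalk [LocallyOfFiniteType q] (y : Y) :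
    letI : Algebra K (Y.presheaf.stalk y) :=
      ((Scheme.ΓSpecIso (.of K)).inv ≫ q.appTop ≫ Y.presheaf.germ ⊤ y trivial).hom.toAlgebra
    Algebra.EssFiniteType K (Y.presheaf.stalk y) := by
  letI : Algebra K (Y.presheaf.stalk y) :=
    ((Scheme.ΓSpecIso (.of K)).inv ≫ q.appTop ≫ Y.presheaf.germ ⊤ y trivial).hom.toAlgebra
  let K' := (Spec (.of K)).presheaf.stalk (q.base y)
  letI : Algebra K K' := (StructureSheaf.toStalk K (q.base y)).hom.toAlgebra
  haveI : IsLocalization.AtPrime K' (q.base y).asIdeal := StructureSheaf.IsLocalization.to_stalk K (q.base y)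
  letI : Algebra K' (Y.presheaf.stalk y) := (q.stalkMap y).hom.toAlgebra
  haveI : IsScalarTower K K' (Y.presheaf.stalk y) := by
    refine IsScalarTower.of_algebraMap_eq' ?_
    exact RingHom.ext fun r =>
      (congrArg (fun f => CommRingCat.Hom.hom f r) (toStalk_comp_stalkMap_eq q y)).symm
  haveI : Algebra.EssFiniteType K K' :=
    Algebra.EssFiniteType.of_isLocalization (R := K) (S := K') (q.base y).asIdeal.primeCompl
  haveI : Algebra.EssFiniteType K' (Y.presheaf.stalk y) := LocallyOfFiniteType.stalkMap q y
  exact Algebra.EssFiniteType.comp K K' (Y.presheaf.stalk y)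

end AnyField

/-! ## §2 (E6) for schemes over `M(t)`, `M` perfect -/

section RatFuncField

variable {M : Type u} [Field M] [PerfectField M] {Y : Scheme.{u}} (q : Y ⟶ Spec (.of (RatFunc M)))

/-- **THE 1-FORM CRITERION, POINTWISE** (`q : Y ⟶ Spec M(t)` locally of finite presentation, `M` perfect, `y ∈ Y`
with `𝒪_{Y,y}` regular; `𝒪_{Y,y}` an `M(t)`- and `M`-algebra through constants): `y` is a smooth point of `q` iff
`dt(y) := 1 ⊗ d(t) ≠ 0` in `κ(y) ⊗ Ω_{𝒪_{Y,y}/M}`. [cite: EGA0IV, Thm. 20.5.7] -/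
theorem mem_smoothLocus_iff_tmul_D_ne_zero [LocallyOfFinitePresentation q] (y : Y)
    [IsRegularLocalRing (Y.presheaf.stalk y)] :
    letI φ := ((Scheme.ΓSpecIso (.of (RatFunc M))).inv ≫ q.appTop ≫ Y.presheaf.germ ⊤ y trivial).hom
    letI : Algebra (RatFunc M) (Y.presheaf.stalk y) := φ.toAlgebra
    letI : Algebra M (Y.presheaf.stalk y) := (φ.comp (algebraMap M (RatFunc M))).toAlgebra
    y ∈ q.smoothLocus ↔
      (1 : ResidueField (Y.presheaf.stalk y)) ⊗ₜ[Y.presheaf.stalk y]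
        KaehlerDifferential.D M (Y.presheaf.stalk y) (φ RatFunc.X) ≠ 0 := by
  letI φ := ((Scheme.ΓSpecIso (.of (RatFunc M))).inv ≫ q.appTop ≫ Y.presheaf.germ ⊤ y trivial).hom
  letI : Algebra (RatFunc M) (Y.presheaf.stalk y) := φ.toAlgebra
  letI : Algebra M (Y.presheaf.stalk y) := (φ.comp (algebraMap M (RatFunc M))).toAlgebra
  haveI : IsScalarTower M (RatFunc M) (Y.presheaf.stalk y) := IsScalarTower.of_algebraMap_eq' rfl
  haveI : Algebra.EssFiniteType (RatFunc M) (Y.presheaf.stalk y) := essFiniteType_stalk q y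
  rw [mem_smoothLocus_iff_formallySmooth_stalk q y]
  exact ratFunc_formallySmooth_iff_tmul_D_ne_zero M (Y.presheaf.stalk y)

/-- **THE 1-FORM CRITERION, GLOBAL** (`q : Y ⟶ Spec M(t)` locally of finite presentation, `M` perfect): `q` is
smooth iff `Y` is a regular scheme and `dt(y) ≠ 0` for every `y ∈ Y` — on a regular `Y` the non-smooth locus of
`q` is the zero locus of the 1-form `dt`. [cite: EGA0IV, Thm. 20.5.7] -/
theorem smooth_iff_isRegular_and_forall_tmul_D_ne_zero [LocallyOfFinitePresentation q] :
    Smooth q ↔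
      Scheme.IsRegular Y ∧
        ∀ y : Y,
          letI φ := ((Scheme.ΓSpecIso (.of (RatFunc M))).inv ≫ q.appTop ≫ Y.presheaf.germ ⊤ y trivial).hom
          letI : Algebra (RatFunc M) (Y.presheaf.stalk y) := φ.toAlgebra
          letI : Algebra M (Y.presheaf.stalk y) := (φ.comp (algebraMap M (RatFunc M))).toAlgebra
          (1 : ResidueField (Y.presheaf.stalk y)) ⊗ₜ[Y.presheaf.stalk y]
            KaehlerDifferential.D M (Y.presheaf.stalk y) (φ RatFunc.X) ≠ 0 := by
  constructor
  · intro hq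
    have hreg : Scheme.IsRegular Y := fun y => isRegularLocalRing_stalk_of_smooth_of_field q y
    refine ⟨hreg, fun y => ?_⟩
    haveI := hreg y
    have hy : y ∈ q.smoothLocus := by
      rw [Scheme.Hom.smoothLocus_eq_top]
      trivial
    exact (mem_smoothLocus_iff_tmul_D_ne_zero q y).mp hy
  · rintro ⟨hreg, h⟩
    rw [← Scheme.Hom.smoothLocus_eq_top_iff, ← top_le_iff]
    intro y _
    haveI := hreg y
    exact (mem_smoothLocus_iff_tmul_D_ne_zero q y).mpr (h y)

end RatFuncField

end Summit.ResolutionOfSingularities.ResolutionOfSingularities.Theorems.CampaignW82
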